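import Summits.BirchSwinnertonDyer.BirchSwinnertonDyer.Theorems.PrintCf2SplitBadTwoRestrictedSelmerNoFiniteSubmoduleSigma
import HarnessLib

/-!
# Crux `PrintCf2.SplitBadTwoRankOneOfFacts` (stmt-BirchSwinnertonDyer-20368), road α — brick B17, file 5:
# THE CANONICAL `Λ`-DUAL OF A `Γ`-STABLE AMBIENT `H ≤ H¹(K_∞, M)` (e.g. the `Σ`-ambient `H_Σ`): `Hom(H, ℚ/ℤ)` with `T ↦ conj_γ − 1` IS a
# Pontryagin-dual datum, so hypothesis (ii)_Σ of files 2–3 is a statement about ONE named module: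
# «`Hom(H_Σ, ℚ/ℤ)` is finitely generated over `Λ` and has no nonzero finite `Λ`-submodule» (Greenberg 2006 Thm. 1 / LNM 1716 Prop. 4.9 shape)

Cell `bsd-print-cf2`, EXTRA WIDTH seat `bsd-line-cf2-p1-w4` g8 (prover-bsd-line-cf2-p1-w4-g8-0); `--supports
stmt-BirchSwinnertonDyer-20368` (helper, Theses-free). HONEST FRAMING: nothing here closes the crux or a registered stub; BSD is
not proved by any of this; no summit statement is proved by this seat. No definition, no named fact, no `sorry` (the module structure is
the tree's `IwasawaDual.IsLocNil.module`, activated with `letI`, exactly as in `Agboola2007.restrictedDualData`).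

* §1 `isLocNil_conjAmbient_sub_one` — for `M` `p`-primary with open stabilisers, `γ` a topological generator and `H ≤ H¹(K_∞, M)` stable
  under `conj_γ`: any endomorphism `ψ` of `H` acting as `conj_γ − 1` is locally nilpotent on the `p`-primary group `H` (Greenberg §1: "every element … is killed by `Tⁿ`");
  `exists_ambientDualData` — hence a Pontryagin-dual datum `(Y, toDual_Y)` for `H` with the two axioms of files 2–3 EXISTS
  (`Y = Hom(H, ℚ/ℤ)`, `toDual = id`): the abstract binders `(Y, dY, hbijY, hTY, hCY)` of `forall_finite_eq_bot_of_ambientDual_of_lift` /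
  `…_of_sigma_ambientDual` are always satisfiable, and (ii)_Σ has CONTENT only in «finitely generated» + «no finite submodule».
* §2 `forall_finite_eq_bot_of_sigma_canonicalDual` — B17 (no nonzero finite `Λ`-submodule of ANY dual datum of `𝔖_𝔮(K_∞, M)`) from:
  the CANONICAL dual `Hom(H_Σ, ℚ/ℤ)` finitely generated without nonzero finite `Λ`-submodules [Greenberg 2006 Thm. 1 for `Ind(M)`] +
  (i)_𝔮 off finitely many `u` + (hvan)_T; and the road-α frame form `noFiniteSubmodule_of_frame_of_sigma_canonicalDual`.
presearch: Greenberg LNM 1716 §1 p. 60, §4 p. 113/117; TURNKEY-20368-B17-w4g8.md §2 — no new fact.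

References: [GreenbergLNM1716] §1 p. 60, §4 Prop. 4.9 (p. 113), p. 117; [Greenberg2006] Thm. 1; [Lang1990] Ch. 5 §1.
-/

noncomputable section

open scoped Classical

set_option linter.dupNamespace false
set_option autoImplicit false

open NumberField IsDedekindDomain Field WeierstrassCurve
open Literature.NumberTheory.EllipticCurves Literature.NumberTheory.EllipticCurves.GreenbergSelmer
open Literature.NumberTheory.EllipticCurves.Agboola2007
open Literature.NumberTheory.EllipticCurves.IwasawaAlgebra
open Literature.NumberTheory.EllipticCurves.IwasawaDual
open Literature.NumberTheory.GaloisRepresentations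

universe u

namespace Summit.BirchSwinnertonDyer.BirchSwinnertonDyer.Theorems.PrintCf2.RestrictedSelmerPair

/-! ## §1. `conj_γ − 1` is locally nilpotent on any `Γ`-stable ambient; the canonical dual datum exists -/

section Canonical

variable {K : Type u} [Field K] [NumberField K] {p : ℕ} [Fact p.Prime] {κ : ZpExtension K p}
  {M : Type u} [AddCommGroup M] [DistribMulAction (absoluteGaloisGroup K) M] [TopologicalSpace M]
  [DiscreteTopology M] {γ : absoluteGaloisGroup K} {Hamb : AddSubgroup (subgroupH1 κ.kerSubgroup M)}

/-- **`T = conj_γ − 1` is locally nilpotent on a `Γ`-stable ambient `H ≤ H¹(K_∞, M)`** and `H` is `p`-primary (`M` `p`-primary with open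
stabilisers, `γ` a topological generator): every class is killed by a power of `p` and by a power of `conj_γ − 1` — the tree's tower lemmas
`exists_pow_smul_subgroupH1_eq_zero`, `exists_conjH1_pow_prime_pow_eq`, `pow_mul_prime_pow_apply_eq_zero`, verbatim the argument of
`Agboola2007.isLocNil_conjRestricted_sub_one`. [cite: GreenbergLNM1716, §1 p. 60 (after Conj. 1.3)] -/
theorem isLocNil_conjAmbient_sub_one (htor : ∀ m : M, ∃ k : ℕ, p ^ k • m = 0)
    (hstab : ∀ m : M, IsOpen (MulAction.stabilizer (absoluteGaloisGroup K) m : Set (absoluteGaloisGroup K)))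
    (hγ : κ.IsTopGenerator γ) (ψ : AddMonoid.End Hamb)
    (hψ : ∀ c : Hamb, ((ψ c : Hamb) : subgroupH1 κ.kerSubgroup M) = conjH1 κ.kerSubgroup M γ c - c) :
    IwasawaDual.IsLocNil p ψ := by
  -- `φ := ψ + 1` acts as `conj_γ`
  set φ : AddMonoid.End Hamb := ψ + 1 with hφdef
  have hφ : ∀ c : Hamb, ((φ c : Hamb) : subgroupH1 κ.kerSubgroup M) = conjH1 κ.kerSubgroup M γ c := fun c ↦ by
    have e : (φ c : Hamb) = ψ c + c := rfl
    rw [e, AddSubgroup.coe_add, hψ, sub_add_cancel]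
  have hφpow : ∀ (m : ℕ) (s : Hamb), (((φ ^ m) s : Hamb) : subgroupH1 κ.kerSubgroup M) = conjH1 κ.kerSubgroup M (γ ^ m) s := by
    intro m
    induction m with
    | zero => intro s; rw [pow_zero, pow_zero, AddMonoid.End.one_apply, conjH1_one_holds κ.kerSubgroup M, AddMonoidHom.id_apply]
    | succ m ih =>
      intro s
      rw [pow_succ, AddMonoid.End.coe_mul, Function.comp_apply, ih, pow_succ, conjH1_mul_holds κ.kerSubgroup M,
        AddMonoidHom.comp_apply, hφ]
  have htor' : ∀ s : Hamb, ∃ k : ℕ, p ^ k • s = 0 := fun s ↦ by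
    obtain ⟨k, hk⟩ := GreenbergSelmer.exists_pow_smul_subgroupH1_eq_zero κ M htor (s : subgroupH1 κ.kerSubgroup M)
    exact ⟨k, Subtype.ext (by rw [AddSubgroupClass.coe_nsmul]; exact hk)⟩
  have hψφ : ψ = φ - 1 := by rw [hφdef, add_sub_cancel_right]
  refine ⟨htor', fun s ↦ ?_⟩
  obtain ⟨a, ha⟩ := GreenbergSelmer.exists_conjH1_pow_prime_pow_eq κ M hstab hγ (s : subgroupH1 κ.kerSubgroup M)
  obtain ⟨k, hk⟩ := htor' s
  have hfix : (φ ^ p ^ a) s = s := Subtype.ext (by rw [hφpow]; exact ha)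
  refine ⟨k * p ^ a, ?_⟩
  rw [hψφ]
  exact IwasawaDual.pow_mul_prime_pow_apply_eq_zero (Fact.out : p.Prime) _ a hfix hk

/-- **The canonical Pontryagin-dual datum of a `Γ`-stable ambient EXISTS**: `Y := Hom(H, ℚ/ℤ)` with the `Λ`-structure
`IwasawaDual.IsLocNil.module` (`T ↦ conj_γ − 1`, constants through `ℤ_p → ℤ/p^k`) and `toDual := id` satisfies the two axioms used by files
2–3 (`hTY`, `hCY`) and is bijective. So the abstract dual-datum binders of `forall_finite_eq_bot_of_ambientDual_of_lift` are always
inhabited; hypothesis (ii)_Σ has content only in «`Y` finitely generated» and «`Y` without nonzero finite `Λ`-submodule».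
[cite: GreenbergLNM1716, §1 p. 60 and §4 p. 117] [cite: Lang1990, Ch. 5 §1] -/
theorem exists_ambientDualData (hH : ∀ c ∈ Hamb, conjH1 κ.kerSubgroup M γ c ∈ Hamb)
    (htor : ∀ m : M, ∃ k : ℕ, p ^ k • m = 0)
    (hstab : ∀ m : M, IsOpen (MulAction.stabilizer (absoluteGaloisGroup K) m : Set (absoluteGaloisGroup K)))
    (hγ : κ.IsTopGenerator γ) :
    ∃ (Y : Type u) (_ : AddCommGroup Y) (_ : Module (IwasawaAlgebra p) Y) (dY : Y →+ (Hamb →+ AddCircle (1 : ℚ))),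
      Function.Bijective dY ∧
      (∀ (y : Y) (c : Hamb), dY ((PowerSeries.X : IwasawaAlgebra p) • y) c =
        dY y ⟨conjH1 κ.kerSubgroup M γ c, hH c c.2⟩ - dY y c) ∧
      (∀ (a : ℤ_[p]) (y : Y) (c : Hamb) (k : ℕ), (p ^ k) • c = 0 →
        dY (PowerSeries.C a • y) c = (PadicInt.toZModPow k a).val • dY y c) := by
  let φ : AddMonoid.End Hamb := ((conjH1 κ.kerSubgroup M γ).restrict Hamb).codRestrict Hamb fun c ↦ hH c c.2
  let ψ : AddMonoid.End Hamb := φ - 1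
  have hψ : ∀ c : Hamb, ((ψ c : Hamb) : subgroupH1 κ.kerSubgroup M) = conjH1 κ.kerSubgroup M γ c - c := fun c ↦ by
    show ((((φ - 1) c : Hamb)) : subgroupH1 κ.kerSubgroup M) = _
    rw [IwasawaDual.End_sub_apply, AddMonoid.End.one_apply, AddSubgroup.coe_sub]
    rfl
  have hln := isLocNil_conjAmbient_sub_one htor hstab hγ ψ hψ
  letI : Module (IwasawaAlgebra p) (Hamb →+ AddCircle (1 : ℚ)) := hln.module
  refine ⟨Hamb →+ AddCircle (1 : ℚ), inferInstance, hln.module, AddMonoidHom.id _, Function.bijective_id, fun y c ↦ ?_,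
    fun a y c k hk ↦ ?_⟩
  · show hln.smulFun PowerSeries.X y c = y _ - y c
    rw [hln.smulFun_X_apply, ← map_sub]
    exact congrArg y (Subtype.ext (by rw [hψ, AddSubgroup.coe_sub]))
  · show hln.smulFun (PowerSeries.C a) y c = _
    exact hln.smulFun_C_apply a y hk

end Canonical

/-! ## §2. B17 from the CANONICAL dual of the `Σ`-ambient -/

section CanonicalSigma

variable {K : Type u} [Field K] [NumberField K] {p : ℕ} [Fact p.Prime] {κ : ZpExtension K p}
  {M : Type u} [AddCommGroup M] [DistribMulAction (absoluteGaloisGroup K) M] [TopologicalSpace M]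
  [DiscreteTopology M] {𝔮 : HeightOneSpectrum (𝓞 K)} {γ : absoluteGaloisGroup K}

/-- **B17 from the canonical dual of `H_Σ`.** `M` `p`-primary with open stabilisers, `γ` a topological generator, `D` a dual datum of
`𝔖_𝔮(K_∞, M)`, `H` with the `Σ`-membership for a set `T` of finite places. If the CANONICAL `Λ`-module `Hom(H, ℚ/ℤ)` (structure
`IsLocNil.module`, §1) is finitely generated and has no nonzero finite `Λ`-submodule [(ii)_Σ: Greenberg 2006 Thm. 1 for `Ind(M)` /
LNM 1716 Prop. 4.9 shape], the lift at `𝔮` fails for finitely many `u ≡ 1 (mod p)` only [(i)_𝔮], and the local groups vanish on `T`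
[(hvan)_T], then `D.X` has no nonzero finite `Λ`-submodule. [cite: GreenbergLNM1716, §4 Prop. 4.9 (p. 113), pp. 117, 122–125]
[cite: Greenberg2006, Thm. 1] -/
theorem forall_finite_eq_bot_of_sigma_canonicalDual (D : RestrictedDualData κ M 𝔮 γ)
    (htor : ∀ m : M, ∃ k : ℕ, p ^ k • m = 0)
    (hstab : ∀ m : M, IsOpen (MulAction.stabilizer (absoluteGaloisGroup K) m : Set (absoluteGaloisGroup K)))
    (hγ : κ.IsTopGenerator γ)
    (T : Set (HeightOneSpectrum (𝓞 K))) (Hamb : AddSubgroup (subgroupH1 κ.kerSubgroup M))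
    (hmem : ∀ c : subgroupH1 κ.kerSubgroup M, c ∈ Hamb ↔
      (∀ w : HeightOneSpectrum (𝓞 K), ((p : ℕ) : 𝓞 K) ∉ w.asIdeal → w ∉ T → ∀ σ : absoluteGaloisGroup K,
          resOfLe M (inf_le_left : κ.kerSubgroup ⊓ decomp w ≤ κ.kerSubgroup) (conjH1 κ.kerSubgroup M σ c) = 0) ∧
      (∀ (w : InfinitePlace K) (σ : absoluteGaloisGroup K),
          resOfLe M (inf_le_left : κ.kerSubgroup ⊓ decompInf w ≤ κ.kerSubgroup) (conjH1 κ.kerSubgroup M σ c) = 0))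
    (ψ : AddMonoid.End Hamb)
    (hψ : ∀ c : Hamb, ((ψ c : Hamb) : subgroupH1 κ.kerSubgroup M) = conjH1 κ.kerSubgroup M γ c - c)
    (hY : letI : Module (IwasawaAlgebra p) (Hamb →+ AddCircle (1 : ℚ)) := (isLocNil_conjAmbient_sub_one htor hstab hγ ψ hψ).module
      Module.Finite (IwasawaAlgebra p) (Hamb →+ AddCircle (1 : ℚ)) ∧
        ∀ N : Submodule (IwasawaAlgebra p) (Hamb →+ AddCircle (1 : ℚ)), Finite N → N = ⊥)
    (hvan : ∀ w ∈ T, ((p : ℕ) : 𝓞 K) ∉ w.asIdeal → ∀ c : subgroupH1 κ.kerSubgroup M,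
      resOfLe M (inf_le_left : κ.kerSubgroup ⊓ decomp w ≤ κ.kerSubgroup) c = 0)
    (hliftAt : {u : ℤ | (p : ℤ) ∣ u - 1 ∧ ¬ ∀ c ∈ Hamb,
      (∀ σ : absoluteGaloisGroup K, resOfLe M (inf_le_left : κ.kerSubgroup ⊓ decomp 𝔮 ≤ κ.kerSubgroup)
          (conjH1 κ.kerSubgroup M σ (u • conjH1 κ.kerSubgroup M γ c - c)) = 0) →
      ∃ c' ∈ Hamb, u • conjH1 κ.kerSubgroup M γ c' - c' = 0 ∧
        ∀ σ : absoluteGaloisGroup K, resOfLe M (inf_le_left : κ.kerSubgroup ⊓ decomp 𝔮 ≤ κ.kerSubgroup)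
          (conjH1 κ.kerSubgroup M σ (c - c')) = 0}.Finite) :
    ∀ N : Submodule (IwasawaAlgebra p) D.X, Finite N → N = ⊥ := by
  have hln := isLocNil_conjAmbient_sub_one htor hstab hγ ψ hψ
  letI : Module (IwasawaAlgebra p) (Hamb →+ AddCircle (1 : ℚ)) := hln.module
  obtain ⟨hfg, hY'⟩ := hY
  haveI := hfg
  refine forall_finite_eq_bot_of_sigma_ambientDual D htor T Hamb hmem (AddMonoidHom.id _) Function.bijective_id
    (fun y c ↦ ?_) (fun a y c k hk ↦ ?_) hY' hvan hliftAt
  · show hln.smulFun PowerSeries.X y c = y _ - y c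
    rw [hln.smulFun_X_apply, ← map_sub]
    exact congrArg y (Subtype.ext (by rw [hψ, AddSubgroup.coe_sub]))
  · show hln.smulFun (PowerSeries.C a) y c = _
    exact hln.smulFun_C_apply a y hk

end CanonicalSigma

end Summit.BirchSwinnertonDyer.BirchSwinnertonDyer.Theorems.PrintCf2.RestrictedSelmerPair

end
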